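import Mathlib.Tactic
import HarnessLib

/-!
# Second-factor Mayer–Vietoris is level-exact for `b' ≥ 2` — the arithmetic core

Kernel certificate (theorems only, linear arithmetic) of the «bad-target» inequalities behind
LEMMA L of `widen/W1/KNEST-w1cx1.md` (W1 cell pub-hsemireg; code B's gauge of record on
`S = E_ω × E_ω`).

A bimonomial `x₁^i y₁^j x₂^k y₂^l` (`i, k ∈ {0,1,2}`, `j, l ∈ ℤ`) has factor levels
`ℓ(i,j) = i + j` for `j ≥ 0` and `= -j` for `j < 0`; «`ℓ(i,j) ≤ L`» is written below as the pair of
implications `(0 ≤ j → i + j ≤ L) ∧ (j < 0 → -j ≤ L)`.  Its restriction to a graph curve is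
`x^(i+k) y^(j+l)` reduced by `x³ = y² + 1`, so it produces the `R`-monomials `x^s y^t` with
`(s,t) = (i+k, j+l)` if `i + k ≤ 2`, `(0, j+l+2), (0, j+l)` if `i + k = 3`, `(1, j+l+2), (1, j+l)` if
`i + k = 4` — the hypothesis `Produced` below, spelled out as a disjunction.  For second-factor
numerator bound `b' ≥ 2` the restrictions of the level-`≤ L` monomials common to both second-factor
charts span every `x^s y^t` that is GOOD at level `L`: `-L ≤ t ≤ L` for `s ≤ 1`, `-L ≤ t ≤ L - 1`
for `s = 2`.  LEMMA L rests on the facts certified here for every `L`: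
`good_surj` (every good target is hit by a common monomial `(i, t, k, 0)`, `k ≤ 1`, of level `≤ L`),
`low_of_neg` (an `l ≤ -1` monomial with both levels `≤ L` produces only good or deep-negative
targets, `t ≤ -L-1`), `high_of_nonneg` (an `l ≥ 0` monomial with first level `≤ L` produces only
`t ≥ -L`), whence `disjoint_bad`; and `boundary_witness` records why `b' = 1` is excluded.
The last block certifies the `b' = 0` variant (LEMMA R0 of the same note): there the common monomials are
`(i, t, 0, 0)` only, GOOD⁰ means `-L ≤ t ≤ L - s`, and the low-side statement holds for `l ≤ -1`
monomials OFF the line `(k, l) = (2, -1)` (`low_of_neg_R0`, `good_surj_R0`, `disjoint_bad_R0`).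
Nothing in this file is a statement about the Hodge conjecture.
-/

namespace Summit.Ventures.HSemireg.SecondFactorLevelExact

/-- Every GOOD target `x^s y^t` at level `L ≥ 1` is the single-term restriction of a common
monomial `x₁^i y₁^t x₂^k` with `k ≤ 1` (so `2k ≤ 2 ≤ b'`), `i + k = s`, and both factor levels
`≤ L` (the second factor `x₂^k` has level `k`). -/
theorem good_surj {L s t : ℤ} (hL : 1 ≤ L) (hs0 : 0 ≤ s) (hs2 : s ≤ 2)
    (hg : -L ≤ t ∧ (s = 2 → t ≤ L - 1) ∧ (s ≠ 2 → t ≤ L)) :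
    ∃ i k : ℤ, 0 ≤ i ∧ i ≤ 2 ∧ 0 ≤ k ∧ k ≤ 1 ∧ i + k = s ∧
      ((0 ≤ t → i + t ≤ L) ∧ (t < 0 → -t ≤ L)) ∧ k ≤ L := by
  rcases hg with ⟨h1, h2, h3⟩
  by_cases hs : s = 2
  · exact ⟨1, 1, by norm_num, by norm_num, by norm_num, by norm_num, by omega,
      ⟨by omega, by omega⟩, by omega⟩
  · by_cases hs1 : s = 1
    · exact ⟨0, 1, by norm_num, by norm_num, by norm_num, by norm_num, by omega,
        ⟨by omega, by omega⟩, by omega⟩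
    · exact ⟨0, 0, by norm_num, by norm_num, by norm_num, by norm_num, by omega,
        ⟨by omega, by omega⟩, by omega⟩

/-- LOW SIDE. A monomial of the second-factor chart `U₁` proper (`l ≤ -1`) whose two factor levels
are `≤ L` produces only targets `x^s y^t` that are good at level `L` or deep-negative:
`t ≤ -L - 1`. -/
theorem low_of_neg {L i j k l s t : ℤ} (hi0 : 0 ≤ i) (hi2 : i ≤ 2) (hk0 : 0 ≤ k) (hk2 : k ≤ 2)
    (hl : l ≤ -1)
    (h1 : (0 ≤ j → i + j ≤ L) ∧ (j < 0 → -j ≤ L)) (h2 : (0 ≤ l → k + l ≤ L) ∧ (l < 0 → -l ≤ L))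
    (hp : (i + k ≤ 2 ∧ s = i + k ∧ t = j + l) ∨
          (i + k = 3 ∧ s = 0 ∧ (t = j + l + 2 ∨ t = j + l)) ∨
          (i + k = 4 ∧ s = 1 ∧ (t = j + l + 2 ∨ t = j + l)))
    (hbad : ¬ (-L ≤ t ∧ (s = 2 → t ≤ L - 1) ∧ (s ≠ 2 → t ≤ L))) : t ≤ -L - 1 := by
  omega

/-- HIGH SIDE. A monomial of the second-factor chart `U₀` (`l ≥ 0`) whose first factor level is
`≤ L` produces only targets with `t ≥ -L`. -/
theorem high_of_nonneg {L i j k l s t : ℤ} (hi0 : 0 ≤ i) (hk0 : 0 ≤ k) (hl : 0 ≤ l)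
    (h1 : (0 ≤ j → i + j ≤ L) ∧ (j < 0 → -j ≤ L))
    (hp : (i + k ≤ 2 ∧ s = i + k ∧ t = j + l) ∨
          (i + k = 3 ∧ s = 0 ∧ (t = j + l + 2 ∨ t = j + l)) ∨
          (i + k = 4 ∧ s = 1 ∧ (t = j + l + 2 ∨ t = j + l))) : -L ≤ t := by
  omega

/-- DISJOINTNESS (the heart of LEMMA L): no target `x^s y^t` that is bad at level `L` is produced
both by an `l ≤ -1` monomial with levels `≤ L` and by an `l' ≥ 0` monomial with first level `≤ L`.
Hence, for a relation `Q` among level-`≤ L` monomials, the bad parts of the restrictions of its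
`l ≤ -1` part and of its `l ≥ 0` part vanish separately, and `V_Z^{≤L} = V₁^{≤L} + V₂^{≤L}`. -/
theorem disjoint_bad {L i j k l i' j' k' l' s t : ℤ}
    (hi0 : 0 ≤ i) (hi2 : i ≤ 2) (hk0 : 0 ≤ k) (hk2 : k ≤ 2) (hl : l ≤ -1)
    (h1 : (0 ≤ j → i + j ≤ L) ∧ (j < 0 → -j ≤ L)) (h2 : (0 ≤ l → k + l ≤ L) ∧ (l < 0 → -l ≤ L))
    (hp : (i + k ≤ 2 ∧ s = i + k ∧ t = j + l) ∨
          (i + k = 3 ∧ s = 0 ∧ (t = j + l + 2 ∨ t = j + l)) ∨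
          (i + k = 4 ∧ s = 1 ∧ (t = j + l + 2 ∨ t = j + l)))
    (hbad : ¬ (-L ≤ t ∧ (s = 2 → t ≤ L - 1) ∧ (s ≠ 2 → t ≤ L)))
    (hi0' : 0 ≤ i') (hk0' : 0 ≤ k') (hl' : 0 ≤ l') (h1' : (0 ≤ j' → i' + j' ≤ L) ∧ (j' < 0 → -j' ≤ L))
    (hp' : (i' + k' ≤ 2 ∧ s = i' + k' ∧ t = j' + l') ∨
           (i' + k' = 3 ∧ s = 0 ∧ (t = j' + l' + 2 ∨ t = j' + l')) ∨
           (i' + k' = 4 ∧ s = 1 ∧ (t = j' + l' + 2 ∨ t = j' + l'))) : False := by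
  have a := low_of_neg hi0 hi2 hk0 hk2 hl h1 h2 hp hbad
  have b := high_of_nonneg hi0' hk0' hl' h1' hp'
  omega

/-- BOUNDARY. For `b' = 1` the common monomials lose `x y^L` and `x² y^(L-1)`; the `U₁`-monomial
`(i,j,k,l) = (0, L, 2, -1)` has both factor levels `≤ L` (`0 + L ≤ L`, `-(-1) ≤ L`) and produces
the then-bad target `x² y^(L-1)`, which is not deep-negative — so LEMMA L genuinely needs
`b' ≥ 2` (machine: late-chart K¹-elements exist for `q - c₁` and `3p - q + c₁`). -/
theorem boundary_witness (L : ℤ) (hL : 1 ≤ L) :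
    (0 + L ≤ L ∧ -(-1 : ℤ) ≤ L) ∧ (0 + 2 ≤ (2 : ℤ) ∧ (2 : ℤ) = 0 + 2 ∧ L - 1 = L + (-1)) ∧
      ¬ (L - 1 ≤ -L - 1) := by
  refine ⟨⟨by omega, by omega⟩, ⟨by norm_num, by norm_num, by omega⟩, by omega⟩

/-! ### The `b' = 0` variant (LEMMA R0): level-exact modulo the line `(k, l) = (2, -1)` -/

/-- `b' = 0`: every GOOD⁰ target `x^s y^t` (`-L ≤ t ≤ L - s`) is the restriction of the common
monomial `x₁^s y₁^t` (second factor trivial) of level `≤ L`. -/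
theorem good_surj_R0 {L s t : ℤ} (hg : -L ≤ t ∧ t ≤ L - s) :
    (0 ≤ t → s + t ≤ L) ∧ (t < 0 → -t ≤ L) := by
  omega

/-- `b' = 0`, LOW SIDE: an `l ≤ -1` monomial OFF the non-bounding line `(k,l) = (2,-1)`, with both
factor levels `≤ L`, produces only targets that are good⁰ or deep-negative (`t ≤ -L-1`). -/
theorem low_of_neg_R0 {L i j k l s t : ℤ} (hi0 : 0 ≤ i) (hi2 : i ≤ 2) (hk0 : 0 ≤ k) (hk2 : k ≤ 2)
    (hl : l ≤ -1) (hN : ¬ (k = 2 ∧ l = -1))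
    (h1 : (0 ≤ j → i + j ≤ L) ∧ (j < 0 → -j ≤ L)) (h2 : (0 ≤ l → k + l ≤ L) ∧ (l < 0 → -l ≤ L))
    (hp : (i + k ≤ 2 ∧ s = i + k ∧ t = j + l) ∨
          (i + k = 3 ∧ s = 0 ∧ (t = j + l + 2 ∨ t = j + l)) ∨
          (i + k = 4 ∧ s = 1 ∧ (t = j + l + 2 ∨ t = j + l)))
    (hbad : ¬ (-L ≤ t ∧ t ≤ L - s)) : t ≤ -L - 1 := by
  omega

/-- `b' = 0`, DISJOINTNESS off the line `(2,-1)`: the heart of LEMMA R0. -/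
theorem disjoint_bad_R0 {L i j k l i' j' k' l' s t : ℤ}
    (hi0 : 0 ≤ i) (hi2 : i ≤ 2) (hk0 : 0 ≤ k) (hk2 : k ≤ 2) (hl : l ≤ -1) (hN : ¬ (k = 2 ∧ l = -1))
    (h1 : (0 ≤ j → i + j ≤ L) ∧ (j < 0 → -j ≤ L)) (h2 : (0 ≤ l → k + l ≤ L) ∧ (l < 0 → -l ≤ L))
    (hp : (i + k ≤ 2 ∧ s = i + k ∧ t = j + l) ∨
          (i + k = 3 ∧ s = 0 ∧ (t = j + l + 2 ∨ t = j + l)) ∨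
          (i + k = 4 ∧ s = 1 ∧ (t = j + l + 2 ∨ t = j + l)))
    (hbad : ¬ (-L ≤ t ∧ t ≤ L - s))
    (hi0' : 0 ≤ i') (hk0' : 0 ≤ k') (hl' : 0 ≤ l') (h1' : (0 ≤ j' → i' + j' ≤ L) ∧ (j' < 0 → -j' ≤ L))
    (hp' : (i' + k' ≤ 2 ∧ s = i' + k' ∧ t = j' + l') ∨
           (i' + k' = 3 ∧ s = 0 ∧ (t = j' + l' + 2 ∨ t = j' + l')) ∨
           (i' + k' = 4 ∧ s = 1 ∧ (t = j' + l' + 2 ∨ t = j' + l'))) : False := by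
  have a := low_of_neg_R0 hi0 hi2 hk0 hk2 hl hN h1 h2 hp hbad
  have b := high_of_nonneg hi0' hk0' hl' h1' hp'
  omega

/-- `b' = 0`: the excluded line is necessary — the monomial `(i,j,k,l) = (0, L, 2, -1)` on the line
has both factor levels `≤ L` (`0 + L ≤ L`, `-(-1) ≤ L`) and produces the target `x² y^(L-1)`, which is
bad⁰ (`L - 1 ≤ L - 2` fails) but NOT deep-negative (`L - 1 ≤ -L - 1` fails for `L ≥ 1`). -/
theorem line_witness_R0 (L : ℤ) (hL : 1 ≤ L) :
    (0 + L ≤ L ∧ -(-1 : ℤ) ≤ L) ∧ ¬ (-L ≤ L - 1 ∧ L - 1 ≤ L - 2) ∧ ¬ (L - 1 ≤ -L - 1) := by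
  refine ⟨⟨by omega, by omega⟩, by omega, by omega⟩

end Summit.Ventures.HSemireg.SecondFactorLevelExact
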